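import Summits.CriticalPhenomena.PercolationContinuityZ3.Theorems.PercNearOneGluingNoHeavyLowerTailSahiLatinZeroBottomRelaxedBridgeCases
import Summits.CriticalPhenomena.PercolationContinuityZ3.Theorems.PercNearOneGluingNoHeavyLowerTailSahiLatinZeroBottomCutFamily

/-!
# `NoHeavyLowerTail` (crux stmt-CriticalPhenomena-4575), Sahi programme (prim-master-conj gen 50): **THE THRESHOLD-RELAXED BRIDGE, part 3/3** — the first
# zero-bottom instances with a NON-PRIVATE cut (`P = [x₀ = 2] ⊂ P′ = [x₀ ≥ 1]`) satisfy the grid invariant, hence TOP₁ with the sharp constant `3/2`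

Support file (`--supports stmt-CriticalPhenomena-4575`; one inductive family (`IsRelaxPad`) + proofs, no `sorry`, standard axioms).  Memo
`run/shared/lean/prim/prim-l12/FROM-prim-master-conj-g50-GENERAL-CORE.md` §8.  Nothing here asserts the crux, Kahn's conjecture or (C¼).

THE MATHEMATICS.  On `[3]^{Fin 1 ⊕ V}` take `P = {x₀ = 2}`, `b = {x₀ = 1}` (so `P′ = {x₀ ≥ 1}`: the prime RELAXES the threshold of `P` on `P`'s own
coordinate — not a private cut, outside `IsCutPad`), `Q = Ω × T`, `c = Ω × Tᶜ` for an ARBITRARY `T ⊆ [3]^V`.  The pointwise relaxation fails here, but the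
FIBREWISE relaxation (`…ZeroBottomFibrewise`: exact along `x₀`, pointwise along `V`) succeeds: parts 1–2 give the chain bound `mRB(η)` (`mRB_le`), and
`Σ_η mRB(η) ≥ 2^q·|Tᶜ| ≥ 0` by the ONE-BLOCK LEMMA of `…ZeroBottomBlock` for the cut `(T, Tᶜ)` of `K₃^{⊗V}` (`sum_mRB_nonneg`; pointwise `psi_bound`).  Hence
`grid4_relaxedBridge`, and with the factor lifts of `…ZeroBottomCoupling` the family `IsRelaxPad` (relaxed-bridge cores, closed under arbitrary up-set
factors on either side): **`three_kappa_top_le_two_kappa_lowerStep_of_isRelaxPad`** — TOP₁(3/2) (`4c₁ ≥ 3c₃`) for `P = A × [x₀=2]`, `P′ = A × [x₀ ≥ 1]` (`A` any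
up-set factor), `Q′ = B × Ω`, `Q = B × T`, every dimension.  HONEST LABEL: one non-private shape; general non-private cuts (conjecture (HC) of the memo),
shared primes, (C¼), TOP₁, FBP(d ≥ 5), Kahn remain OPEN. [this work]
-/

namespace Summit.CriticalPhenomena.PercolationContinuityZ3.Theorems.SahiLatin

open Finset

section instance_
variable {V : Type} [Fintype V] [DecidableEq V] (T : Finset (Pt V))

/-! ## §4  The sum of the chain bounds -/

/-- Pointwise: `−X ≤ −2c + 2(2c − X)⁺ − (X − 4c)⁺` for `0 ≤ c ≤ X`. [this work] -/
theorem psi_bound {X c : ℤ} (h0 : 0 ≤ c) (hX : c ≤ X) : -X ≤ -2 * c + 2 * max (2 * c - X) 0 - max (X - 4 * c) 0 := by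
  rcases le_or_gt (2 * c) X with h1 | h1 <;> rcases le_or_gt (4 * c) X with h2 | h2
  · rw [max_eq_right (by linarith), max_eq_left (by linarith)]; linarith
  · rw [max_eq_right (by linarith), max_eq_right (by linarith)]; linarith
  · rw [max_eq_left (by linarith), max_eq_left (by linarith)]; linarith
  · rw [max_eq_left (by linarith), max_eq_right (by linarith)]; linarith

/-- **The chain bounds have nonnegative total**: `Σ_η mRB(η) ≥ 0` (indeed `≥ 2^q·|Tᶜ|`), by the one-block lemma for the cut `(T, Tᶜ)`. [this work] -/
theorem sum_mRB_nonneg : 0 ≤ ∑ η, mRB T η := by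
  rw [← sum_add_sum_compl T]
  have hin : ∀ η ∈ T, -2 * (N Tᶜ η : ℤ) - 2 * max (2 * (N Tᶜ η : ℤ) - 2 ^ Fintype.card V) 0 ≤ mRB T η := by
    intro η hη
    unfold mRB; rw [if_pos hη]
    have h0 : (0 : ℤ) ≤ N Tᶜ η := by positivity
    rcases le_or_gt (2 * (N Tᶜ η : ℤ)) (2 ^ Fintype.card V) with h | h
    · rw [max_eq_right (by linarith), min_eq_right (by linarith)]; linarith
    · rw [max_eq_left (by linarith), min_eq_left (by linarith)]; linarith
  have hout : ∀ η ∈ Tᶜ, 2 * 2 ^ Fintype.card V + 2 * (N T η : ℤ) - max (2 ^ Fintype.card V - 4 * (N T η : ℤ)) 0 ≤ mRB T η := by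
    intro η hη
    have hη' : η ∉ T := by simpa using hη
    unfold mRB; rw [if_neg hη']
    have e : (N Tᶜ η : ℤ) = 2 ^ Fintype.card V - N T η := by
      have h' : (N T η : ℤ) + N Tᶜ η = 2 ^ Fintype.card V := by exact_mod_cast N_add_N_compl T η
      linarith
    rw [e]
    rcases le_or_gt (4 * (N T η : ℤ)) (2 ^ Fintype.card V) with h | h
    · rw [max_eq_left (by linarith), min_eq_right (by linarith)]; linarith
    · rw [max_eq_right (by linarith), min_eq_left (by linarith)]; linarith
  have hpsi : ∀ η ∈ Tᶜ, -(2 : ℤ) ^ Fintype.card V ≤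
      -2 * (N T η : ℤ) + 2 * max (2 * (N T η : ℤ) - 2 ^ Fintype.card V) 0 - max (2 ^ Fintype.card V - 4 * (N T η : ℤ)) 0 :=
    fun η _ => psi_bound (by positivity) (by exact_mod_cast N_le T η)
  have ob := sum_posPart_cross_le T
  have eA := sum_N_comm T Tᶜ
  have S1 := sum_le_sum hin
  have S2 := sum_le_sum hout
  have S3 := sum_le_sum hpsi
  simp only [sum_sub_distrib, sum_add_distrib, ← mul_sum, sum_const, nsmul_eq_mul] at S1 S2 S3
  have hcard : (0 : ℤ) ≤ (Tᶜ.card : ℤ) * 2 ^ Fintype.card V := by positivity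
  linarith

/-! ## §5  The relaxed bridge satisfies the grid invariant -/

/-- **THE THRESHOLD-RELAXED BRIDGE**: `Grid4 ({x₀=2}) ({x₀=1}) (Ω×T) (Ω×Tᶜ)` on `[3]^{Fin 1 ⊕ V}` for every `T ⊆ [3]^V`. [this work] -/
theorem grid4_relaxedBridge : Grid4 (cylL (lvl 2) : Finset (Pt (Fin 1 ⊕ V))) (cylL (lvl 1)) (cylR T) (cylR Tᶜ) :=
  grid4_of_fibrewise (mRB T) (sum_mRB_nonneg T) fun η JSS JSO JOS JOO u1 u2 u3 u4 n1 n2 n3 n4 f1 f2 f3 =>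
    mRB_le T η JSS JSO JOS JOO u1 u2 u3 u4 n1 n2 n3 n4 f1 f2 f3

end instance_

/-! ## §6  The family and the theorem -/

/-- **The relaxed-bridge family**: relaxed-bridge cores, closed under arbitrary up-set factor lifts on either side. [this work] -/
inductive IsRelaxPad : ∀ (κ : Type) [Fintype κ] [DecidableEq κ], Finset (Pt κ) → Finset (Pt κ) → Finset (Pt κ) → Finset (Pt κ) → Prop
  | rcore {V : Type} [Fintype V] [DecidableEq V] (T : Finset (Pt V)) :
      IsRelaxPad (Fin 1 ⊕ V) (cylL (lvl 2)) (cylL (lvl 1)) (cylR T) (cylR Tᶜ)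
  | factorP {W κ : Type} [Fintype W] [DecidableEq W] [Fintype κ] [DecidableEq κ] {A : Finset (Pt W)} (hA : IsUpperSet (A : Set (Pt W)))
      {P b Q c : Finset (Pt κ)} :
      IsRelaxPad κ P b Q c → IsRelaxPad (W ⊕ κ) (cylL A ∩ cylR P) (cylL A ∩ cylR b) (cylR Q) (cylR c)
  | factorQ {W κ : Type} [Fintype W] [DecidableEq W] [Fintype κ] [DecidableEq κ] {B : Finset (Pt W)} (hB : IsUpperSet (B : Set (Pt W)))
      {P b Q c : Finset (Pt κ)} :
      IsRelaxPad κ P b Q c → IsRelaxPad (W ⊕ κ) (cylR P) (cylR b) (cylL B ∩ cylR Q) (cylL B ∩ cylR c)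

/-- `Grid4` on the relaxed-bridge family. [this work] -/
theorem grid4_of_isRelaxPad {κ : Type} [Fintype κ] [DecidableEq κ] {P b Q c : Finset (Pt κ)} (h : IsRelaxPad κ P b Q c) : Grid4 P b Q c := by
  induction h with
  | rcore T => exact grid4_relaxedBridge T
  | factorP hA _ ih => exact grid4_factorP hA ih
  | factorQ hB _ ih => exact grid4_factorQ hB ih

/-- The two level sets `{x₀ = 2}` and `{x₀ = 1}` give disjoint cylinders. [this work] -/
theorem disjoint_cylL_lvl {V : Type} [Fintype V] [DecidableEq V] :
    Disjoint (cylL (lvl 2) : Finset (Pt (Fin 1 ⊕ V))) (cylL (lvl 1)) := by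
  rw [disjoint_left]
  intro u hu hu'
  rw [mem_cylL] at hu hu'
  simp only [lvl, mem_filter, mem_univ, true_and] at hu hu'
  rw [hu] at hu'
  exact absurd hu' (by decide)

/-- The invariants carried along the family: `P ∩ b = ∅`, `Q ∩ c = ∅`, `P ⊥ Q`. [this work] -/
theorem invariants_of_isRelaxPad {κ : Type} [Fintype κ] [DecidableEq κ] {P b Q c : Finset (Pt κ)} (h : IsRelaxPad κ P b Q c) :
    Disjoint P b ∧ Disjoint Q c ∧ Indep P Q := by
  induction h with
  | rcore T =>
    refine ⟨disjoint_cylL_lvl, ?_, indep_cylL_cylR _ _⟩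
    rw [cylR_compl]; exact disjoint_compl_right
  | @factorP W κ _ _ _ _ A hA P b Q c _ ih => exact ⟨disjoint_factor A ih.1, disjoint_cylR ih.2.1, indep_factorP A ih.2.2⟩
  | @factorQ W κ _ _ _ _ B hB P b Q c _ ih => exact ⟨disjoint_cylR ih.1, disjoint_factor B ih.2.1, (indep_factorP B ih.2.2.symm).symm⟩

/-- **TOP-SLICE DOMINANCE WITH THE SHARP CONSTANT `3/2` ON THE RELAXED-BRIDGE FAMILY** (the first family with a NON-PRIVATE cut; every dimension):
for every member `(P, b, Q, c)` of `IsRelaxPad` and every up-set `F ⊇ P ∪ Q`,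
`3 · κ(F, P ∪ b, Q ∪ c) ≤ 2 · κ(ofSections F F F, ofSections P P (P ∪ b), ofSections Q Q (Q ∪ c))`. [this work] -/
theorem three_kappa_top_le_two_kappa_lowerStep_of_isRelaxPad {κ : Type} [Fintype κ] [DecidableEq κ] {P b Q c : Finset (Pt κ)}
    (h : IsRelaxPad κ P b Q c) {F : Finset (Pt κ)} (hF : IsUpperSet (F : Set (Pt κ))) (hPQ : P ∪ Q ⊆ F) :
    3 * kappa F (P ∪ b) (Q ∪ c) ≤ 2 * kappa (ofSections F F F) (ofSections P P (P ∪ b)) (ofSections Q Q (Q ∪ c)) := by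
  obtain ⟨hPb, hQc, hI⟩ := invariants_of_isRelaxPad h
  have h0 : kappa F P Q = 0 := kappa_eq_zero_of_indep_of_union_subset hI hPQ
  have hb : (P ∪ b) \ P = b := by
    rw [union_sdiff_left, Finset.sdiff_eq_self_iff_disjoint]; exact hPb.symm
  have hc : (Q ∪ c) \ Q = c := by
    rw [union_sdiff_left, Finset.sdiff_eq_self_iff_disjoint]; exact hQc.symm
  have key := (three_kappa_top_le_iff_psi_nonneg (F := F) (subset_union_left (s₁ := P) (s₂ := b))
    (subset_union_left (s₁ := Q) (s₂ := c)) h0).2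
  rw [hb, hc] at key
  exact key (psi_nonneg_of_grid4 (grid4_of_isRelaxPad h) hF hPQ)


end Summit.CriticalPhenomena.PercolationContinuityZ3.Theorems.SahiLatin

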